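import Summits.QuantumAdvantage.QuantumAdvantage.Theorems.SparsityDialA

/-! # SparsityDialB — part 2/3 (mechanical split for landing of `SparsityDial`; content verbatim; scopes re-opened with their variables) -/

set_option linter.dupNamespace false
set_option linter.unusedVariables false
noncomputable section
open scoped Classical

namespace Summit.QuantumAdvantage.QuantumAdvantage.Theorems.SparsityDial
open Finset
open Literature.Computability.QuantumComplexity Literature.Computability.QuantumComplexity.RingHLF
open Literature.Computability.MetaComplexity Literature.Computability.MetaComplexity.Smolensky
open Summit.QuantumAdvantage.AdviceFreeQNC0
open Summit.QuantumAdvantage.QuantumAdvantage.Theses (ExactnessDial.PolyLossOddU3 ExactnessDial.DPLift3)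
open Summit.QuantumAdvantage.QuantumAdvantage.Theorems.HolonomyDial (selP selP_mem selP_apply xorP xorP_mem
  xorP_apply_bool tPoly tPoly_mem tPoly_apply closes_T)
open Summit.QuantumAdvantage.QuantumAdvantage.Theorems.AnchorDial (outB dev loss_shape_mono card_odd_ge)
open Summit.QuantumAdvantage.QuantumAdvantage.Theorems.LocusDial (Coverable FewLocus FewLocusLossOne3
  coverable_mono_m Coverable.card_le dev_tPoly fewLocusLossOne3_of_fewLocusLoss3)
open Summit.QuantumAdvantage.QuantumAdvantage.Theorems.StabilizerDial (StabFew pad pad_mem winset_pad deg_pad_stab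
  stabFew_of_fewLocus bitP bitP_pad rowMask apIdx apStrat apStrat_mem bitP_apStrat mem_dev_pad_apStrat_iff BlockRec
  fibreIdentityAt_of_block oddSliceBound_holds goodBound_of_blockRec blockSelect_of_fewLocus eventually_polylog
  side_bounds polyLossOddU3_of_stabPos stabGenericLossPos3_of_polyLossOddU3 antipodalGenericPos3)
variable {N : ℕ}

/-! ## §4  CERTIFICATES OF STRICT WEAKNESS

### E1 — the antipodal family cannot be cheaply localised to polylog-many polylog-wide windows -/

/-- **E1.** For every `a, e`, eventually NO gauge of degree `(log₂ n)^e` turns the antipodal family into a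
`((log₂ n)^a, (log₂ n)^a)`-few-locus strategy.  (The landed block lemmas with window budget `m = r = (log₂ n)^a`:
all side conditions are `≤ K·(log₂ n)^{2a+2e} ≤ n/2`.) -/
theorem apStrat_not_polylogLocal (a e : ℕ) : ∃ n₀ : ℕ, ∀ n ≥ n₀,
    ¬ StabFew ((Nat.log 2 n) ^ a) ((Nat.log 2 n) ^ a) e (fun i : Fin n => apStrat i) := by
  set K : ℕ := 72 * 279936 + 40 with hKdef
  obtain ⟨n₀, hn₀⟩ := eventually_polylog K (2 * a + 2 * e)
  refine ⟨n₀, fun n hn hStab => ?_⟩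
  obtain ⟨hKn, hL⟩ := hn₀ n hn
  obtain ⟨s, hs, hF⟩ := hStab
  set L := Nat.log 2 n with hLdef
  set M := L ^ a with hMdef
  set k : ℕ := 3456 * (8 * L ^ e + 1) ^ 2 with hkdef
  have hL1 : 1 ≤ L := le_trans (by norm_num) hL
  have hM1 : 1 ≤ M := Nat.one_le_pow _ _ hL1
  have hLe : 1 ≤ L ^ e := Nat.one_le_pow _ _ hL1
  have hk_le : k ≤ 279936 * L ^ (2 * e) := by
    have h81 : (8 * L ^ e + 1) ^ 2 ≤ 81 * (L ^ e) ^ 2 := by nlinarith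
    calc k = 3456 * (8 * L ^ e + 1) ^ 2 := rfl
      _ ≤ 3456 * (81 * (L ^ e) ^ 2) := Nat.mul_le_mul_left _ h81
      _ = 279936 * L ^ (2 * e) := by ring
  have hLL : 1 ≤ L ^ (2 * e) := Nat.one_le_pow _ _ hL1
  -- the side-condition carrier `((32M+40)·279936 + 32 M² + 8)·L^{2e} ≤ K·L^{2a+2e} ≤ n/2`
  have hcar : ((32 * M + 40) * 279936 + 32 * (M * M) + 8) * L ^ (2 * e) ≤ n / 2 := by
    have h1 : (32 * M + 40) * 279936 + 32 * (M * M) + 8 ≤ K * (M * M) := by rw [hKdef]; nlinarith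
    calc ((32 * M + 40) * 279936 + 32 * (M * M) + 8) * L ^ (2 * e) ≤ K * (M * M) * L ^ (2 * e) :=
          Nat.mul_le_mul_right _ h1
      _ = K * L ^ (2 * a + 2 * e) := by rw [hMdef]; ring
      _ ≤ n / 2 := hKn
  have hside : 2 * k + 4 ≤ n / 2 ∧ 32 * M * (k + M) + k + 1 ≤ n / 2 := by
    obtain ⟨h1, h2⟩ := side_bounds M M (L ^ (2 * e)) k hLL hk_le
    exact ⟨le_trans h1 hcar, le_trans h2 hcar⟩
  obtain ⟨hk2, hmk⟩ := hside
  -- block selection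
  obtain ⟨b, hb1, hbk, hBad⟩ := blockSelect_of_fewLocus M M k n s hF hk2
  have hk3 : 3 ≤ k := by
    calc (3 : ℕ) ≤ 3456 * 1 := by norm_num
      _ ≤ 3456 * (8 * L ^ e + 1) ^ 2 := Nat.mul_le_mul_left _ (Nat.one_le_pow _ _ (by omega))
  have hGood := goodBound_of_blockRec n e b k s hs (le_of_eq hkdef.symm) hb1 hbk
    (fibreIdentityAt_of_block n b k hk3 hb1 hbk) (oddSliceBound_holds n)
  set G := (univ.filter fun x : Fin n → Bool => OddZeros x ∧ BlockRec s b k x).card with hGdef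
  set Bd := (univ.filter fun x : Fin n → Bool => OddZeros x ∧ ¬ BlockRec s b k x).card with hBdef
  have hn3 : 3 ≤ n := by
    have : 2 * k + 4 ≤ n := le_trans hk2 (Nat.div_le_self _ _)
    omega
  have hOdd : 2 ^ (n - 1) ≤ G + Bd := by
    calc 2 ^ (n - 1) ≤ (univ.filter fun x : Fin n → Bool => OddZeros x).card := card_odd_ge (by omega)
      _ ≤ G + Bd := by
        rw [hGdef, hBdef, ← Finset.card_union_of_disjoint]
        · refine card_le_card fun x hx => ?_
          rw [mem_filter] at hx
          rw [mem_union, mem_filter, mem_filter]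
          by_cases hB : BlockRec s b k x
          · exact Or.inl ⟨hx.1, hx.2, hB⟩
          · exact Or.inr ⟨hx.1, hx.2, hB⟩
        · rw [Finset.disjoint_left]
          intro x h1 h2
          rw [mem_filter] at h1 h2
          exact h2.2.2 h1.2.2
  set A := n / 2 - k - 1 with hAdef
  have hA : 32 * M * (k + M) ≤ A := by rw [hAdef]; omega
  have hApos : 1 ≤ A := by rw [hAdef]; omega
  have hP : 0 < 2 ^ (n - 1) := Nat.two_pow_pos _
  have hBd16 : 16 * (A * L * Bd) ≤ A * L * 2 ^ (n - 1) + 2 * (A * L * 2 ^ (n - 1)) := by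
    have h1 : 16 * (A * 2 ^ (n - 1)) ≤ A * L * 2 ^ (n - 1) := by
      calc 16 * (A * 2 ^ (n - 1)) = A * 16 * 2 ^ (n - 1) := by ring
        _ ≤ A * L * 2 ^ (n - 1) := Nat.mul_le_mul_right _ (Nat.mul_le_mul_left _ hL)
    have h2 : 16 * (L * (2 * M * (k + M)) * 2 ^ (n - 1)) ≤ 2 * (A * L * 2 ^ (n - 1)) := by
      have : 16 * (2 * M * (k + M)) ≤ A := by nlinarith
      calc 16 * (L * (2 * M * (k + M)) * 2 ^ (n - 1)) = (16 * (2 * M * (k + M))) * L * 2 ^ (n - 1) := by ring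
        _ ≤ A * L * 2 ^ (n - 1) := Nat.mul_le_mul_right _ (Nat.mul_le_mul_right _ this)
        _ ≤ 2 * (A * L * 2 ^ (n - 1)) := by omega
    calc 16 * (A * L * Bd) ≤ 16 * (A * 2 ^ (n - 1) + L * (2 * M * (k + M)) * 2 ^ (n - 1)) :=
          Nat.mul_le_mul_left _ hBad
      _ = 16 * (A * 2 ^ (n - 1)) + 16 * (L * (2 * M * (k + M)) * 2 ^ (n - 1)) := by ring
      _ ≤ _ := Nat.add_le_add h1 h2
  have hBd : 16 * Bd ≤ 3 * 2 ^ (n - 1) := by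
    have hAL : 0 < A * L := Nat.mul_pos (by omega) (by omega)
    have : A * L * (16 * Bd) ≤ A * L * (3 * 2 ^ (n - 1)) := by
      calc A * L * (16 * Bd) = 16 * (A * L * Bd) := by ring
        _ ≤ A * L * 2 ^ (n - 1) + 2 * (A * L * 2 ^ (n - 1)) := hBd16
        _ = A * L * (3 * 2 ^ (n - 1)) := by ring
    exact Nat.le_of_mul_le_mul_left this hAL
  have hG : 16 * G ≤ 12 * 2 ^ (n - 1) := by
    have h2n : 2 ^ n = 2 ^ (n - 1) * 2 := by
      conv_lhs => rw [show n = (n - 1) + 1 by omega]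
      exact pow_succ 2 (n - 1)
    have h8 : 8 * G ≤ 3 * (2 ^ (n - 1) * 2) := h2n ▸ hGood
    omega
  have := Nat.mul_le_mul_left 16 hOdd
  omega

/-- E1, width-`0` form: the antipodal family has no cheap `(log₂ n)^a`-POINT normal form, at any level. -/
theorem apStrat_not_polylogSparse (a e : ℕ) : ∃ n₀ : ℕ, ∀ n ≥ n₀,
    ¬ StabFew ((Nat.log 2 n) ^ a) 0 e (fun i : Fin n => apStrat i) := by
  obtain ⟨n₀, hn₀⟩ := apStrat_not_polylogLocal a e
  refine ⟨max n₀ 2, fun n hn h => hn₀ n (le_of_max_le_left hn) ?_⟩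
  exact stabFew_mono_mr le_rfl (one_le_logpow (le_of_max_le_right hn) a) (Nat.zero_le _) h

/-- **D_a's hypothesis class is inhabited at EVERY scale** (by a degree-3 family; what `S` never speaks about):
`S = SparseGenericLoss3` is STRICTLY weaker than `G`. -/
theorem dense_class_nonempty (a c : ℕ) (hc : 1 ≤ c) :
    ∃ n₀ : ℕ, ∀ n ≥ n₀, ∃ P : Fin n → CubeFn (ZMod 3) n,
      (∀ i, P i ∈ lowDeg (ZMod 3) n ((Nat.log 2 n) ^ c)) ∧ ¬ StabFew ((Nat.log 2 n) ^ a) 0 (c + 1) P := by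
  obtain ⟨n₀, hn₀⟩ := apStrat_not_polylogSparse a (c + 1)
  refine ⟨max n₀ 8, fun n hn => ⟨fun i => apStrat i, fun i => ?_, hn₀ n (le_trans (le_max_left _ _) hn)⟩⟩
  have h8 : 2 ^ 3 ≤ n := le_trans (le_max_right _ _) hn
  have hL : 3 ≤ Nat.log 2 n := Nat.le_log_of_pow_le (by norm_num) h8
  have h3 : 3 ≤ (Nat.log 2 n) ^ c :=
    calc 3 ≤ Nat.log 2 n := hL
      _ = (Nat.log 2 n) ^ 1 := (pow_one _).symm
      _ ≤ (Nat.log 2 n) ^ c := Nat.pow_le_pow_right (by omega) hc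
  exact lowDeg_mono h3 (apStrat_mem i)



end Summit.QuantumAdvantage.QuantumAdvantage.Theorems.SparsityDial
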